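import Summits.HodgeConjecture.HodgeConjecture.Theorems.F0P3ArchTokenSeam               -- ★ `areGKEquivalent_of_tokens`, `token_type_eq_one∕neg_one_…_cpt`; ★ `F0P3StubF1aCM.stubF1aCM_holds`, ★ `exists_cohToken_of_isHolOrAntihol_cpt`
import Literature.RepresentationTheory.BorelWallach2000.UpqTypeFunctoriality            -- ★ `upqTypeClasses_eq_bot_iff_of_equiv`, `GKEquiv.comm𝔤∕commK`
import HarnessLib

/-!
# Crux `H413`, half A line LH1 — EVERY `(𝔤,K)`-TOKEN OF A COTANGENT `P` IS COHOMOLOGICAL (compact CM datum, in-house)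

Cell `hodgecm-mathlib`, F0∕P3c line LH1, prover LH1-p04 (g3); crux item H413 = `stmt-HodgeConjecture-24833` (`--supports`), route of record
`HCCMUnconditional`.  THEOREMS ONLY (no `def`, no instance, no notation, no named fact, no `sorry`).  Engine-side input of the EQUIVALENCE CERTIFICATE of the
LH1 pay-down skeleton ED. 2 «χ» (organs FIN ∕ GLOBAL-ι^χ ∕ PIN-τ of `Cruxes/H413/Lines/F0_P3c_S2SharpPaydown.lean`; desk ruling D62-pre «χ» (c3): the organ
GLOBAL-ι^χ quantifies over an ARBITRARY irreducible token `M` of `P.archModuleCM ι T hT`, WITHOUT the antecedent `H¹_δ(M) ≠ ⊥`).  This file shows that the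
dropped antecedent is a THEOREM on the cotangent locus:

* §1 `exists_upqTypeClasses_ne_bot_of_token_cpt` — `H` definite away from `ι`, `[L⁺:ℚ] ≥ 2`, `P` discrete of holomorphic OR antiholomorphic cotangent
  type at the CM frame: every irreducible `(M, σK, σ𝔤)` receiving a non-zero `(𝔤,K)`-map from `P.archModuleCM ι T hT` has `H¹_δ(𝔤,K;M) ≠ ⊥` for some
  `δ ∈ {±1}`.  PROOF: `P` has ONE cohomological token `(M₀, δ₀)` (★ K4 `exists_cohToken_of_isHolOrAntihol_cpt`); all tokens of `P` are `(𝔤,K)`-equivalent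
  (★ `areGKEquivalent_of_tokens` over letter F1a at the CM section, ★ in-house `stubF1aCM_holds`); `H¹_δ` is invariant under `(𝔤,K)`-equivalence
  (★ `upqTypeClasses_eq_bot_iff_of_equiv`).  Sign-resolved forms `upqTypeClasses_one_ne_bot_of_token_of_isHolCotangentAt_cpt` (`δ = 1`) and
  `upqTypeClasses_neg_one_ne_bot_of_token_of_isAntiholCotangentAt_cpt` (`δ = −1`) via ★ `token_type_eq_one∕neg_one_…_cpt`.
HONEST LABEL: HC_CM is proved only modulo the 7 printed citations (2 remaining: hLiu418 = stmt-HodgeConjecture-24832, h413 = stmt-HodgeConjecture-24833)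
until rung 0 closes; nothing printed is discharged here.

References: [BorelWallach2000] A. Borel, N. Wallach, *Continuous cohomology, discrete subgroups, and representations of reductive groups*, 2nd ed.
(2000), I §4.3, II §4.2 (3), VI Thm. 4.11; [Rogawski1990] J. Rogawski, *Automorphic representations of unitary groups in three variables* (1990),
Prop. 15.2.1 (b), §15.3; [FlathCorvallis1979] D. Flath, Corvallis 33.1, Thm. 3–4; [KnappVogan1995] A. Knapp, D. Vogan, *Cohomological induction and
unitary representations* (1995), App. A (A.17).
-/

set_option autoImplicit false
-- the mandated namespace repeats `HodgeConjecture.HodgeConjecture`, as in every `Theorems/*.lean` of this sub-problem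
set_option linter.dupNamespace false

-- Mathlib idiom (as in ★ `GKModules`, the `Upq*` files and every `(𝔤, K)` file of this sub-problem): commutator bracket on `Module.End`
attribute [local instance 100] LieRing.ofAssociativeRing

noncomputable section

namespace Summit.HodgeConjecture.HodgeConjecture.Cruxes.H413.F0P3cArchTokenCohomological

open NumberField NumberField.InfinitePlace MeasureTheory
open scoped Matrix MatrixGroups ComplexOrder
open Literature.NumberTheory.Automorphic Literature.NumberTheory.Automorphic.UnitaryGroup
open Literature.NumberTheory.Automorphic.UnitaryGroup.CotangentForms (cmArchSection cmCompactFactor)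
open Literature.RepresentationTheory.BorelWallach2000
open Literature.RepresentationTheory.KonnoKonno2007 Literature.RepresentationTheory.KonnoKonno2007.RealDualPair
open Literature.RepresentationTheory.KonnoKonno2007.RealDualPair.UForm
open Summit.HodgeConjecture.HodgeConjecture.Cruxes.H413.F0P3ArchTokenSeam
open Summit.HodgeConjecture.HodgeConjecture.Cruxes.H413.F0P3SLayerFoldShapes (exists_cohToken_of_isHolOrAntihol_cpt)

/-! ## §1 Every token of a cotangent `P` is cohomological (compact CM datum) -/

section Cpt

variable (L : Type) [Field L] [NumberField L] [IsCMField L] (ι : L →+* ℂ) (H : Matrix (Fin 3) (Fin 3) L) (T : GL (Fin 3) ℂ)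
  (hT : (T : Matrix (Fin 3) (Fin 3) ℂ)ᴴ * H.map ι * (T : Matrix (Fin 3) (Fin 3) ℂ) = Literature.Geometry.ComplexHyperbolic.BallModel.J)
  (μ : Measure (adelicGroupData (↥(maximalRealSubfield L)) L (IsCMField.complexConj L) 3 H).automorphicQuotient)
  [(adelicGroupData (↥(maximalRealSubfield L)) L (IsCMField.complexConj L) 3 H).IsAutomorphicMeasure μ]
  {M : Type} [AddCommGroup M] [Module ℂ M]
  {σK : Representation ℂ (uFormGroup (Fin 2) (Fin 1)).maximalCompact M}
  {σ𝔤 : (uFormGroup (Fin 2) (Fin 1)).lie →ₗ⁅ℝ⁆ Module.End ℂ M}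

/-- **Every token of a cotangent `P` is cohomological.**  `H` definite away from `ι`, `[L⁺:ℚ] ≥ 2`, `P` discrete of holomorphic or antiholomorphic
cotangent type at the CM frame: an irreducible `(M, σK, σ𝔤)` receiving a non-zero `(𝔤,K)`-map `T₁` from `P.archModuleCM ι T hT` has a non-zero
degree-one class of some type `δ ∈ {±1}`.  (`P` has a cohomological token ★ `exists_cohToken_of_isHolOrAntihol_cpt`; two tokens of `P` are
`(𝔤,K)`-equivalent ★ `areGKEquivalent_of_tokens` over F1a-CM ★ `stubF1aCM_holds`; `H¹_δ` is a `(𝔤,K)`-invariant ★ `upqTypeClasses_eq_bot_iff_of_equiv`.)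
[cite: BorelWallach2000, II §4.2 (3); VI Thm. 4.11] [cite: Rogawski1990, Prop. 15.2.1 (b); §15.3] [cite: FlathCorvallis1979, Thm. 3 and Thm. 4] -/
theorem exists_upqTypeClasses_ne_bot_of_token_cpt
    (hdef : ∀ τ' : L →+* ℂ, InfinitePlace.mk τ' ≠ InfinitePlace.mk ι → (H.map τ').PosDef) (h2 : 2 ≤ Module.finrank ℚ ↥(maximalRealSubfield L))
    (P : DiscreteAutomorphicRep (adelicGroupData (↥(maximalRealSubfield L)) L (IsCMField.complexConj L) 3 H) μ)
    (hP : P.IsHolCotangentAt (cmArchSection L ι H T hT) (cmCompactFactor L ι H T hT) ∨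
      P.IsAntiholCotangentAt (cmArchSection L ι H T hT) (cmCompactFactor L ι H T hT))
    (hM : IsGKModule (uFormGroup (Fin 2) (Fin 1)) σK σ𝔤) (hirr : IsIrreducibleGK σK σ𝔤)
    (T₁ : P.archModuleCM ι T hT →ₗ[ℂ] M)
    (hT₁K : ∀ (k : (uFormGroup (Fin 2) (Fin 1)).maximalCompact) (w : P.archModuleCM ι T hT),
      T₁ (P.archRepKCM ι T hT k w) = σK k (T₁ w))
    (hT₁𝔤 : ∀ (X : (uFormGroup (Fin 2) (Fin 1)).lie) (w : P.archModuleCM ι T hT),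
      T₁ (P.archRepLieCM ι T hT X w) = σ𝔤 X (T₁ w))
    (hT₁ : T₁ ≠ 0) :
    ∃ δ : ℤ, (δ = 1 ∨ δ = -1) ∧ upqTypeClasses σK σ𝔤 hM.ad_compat 1 δ ≠ ⊥ := by
  obtain ⟨M₀, _, _, σK₀, σ𝔤₀, hM₀, δ, hδ, hirr₀, ⟨T₀, hT₀K, hT₀𝔤, hT₀⟩, hne₀⟩ :=
    exists_cohToken_of_isHolOrAntihol_cpt L ι H T hT μ hdef h2 P hP
  obtain ⟨e⟩ := areGKEquivalent_of_tokens ι T hT P (F0P3StubF1aCM.stubF1aCM_holds L ι H T hT hdef h2 μ P hP)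
    hirr T₁ hT₁K hT₁𝔤 hT₁ hirr₀ T₀ hT₀K hT₀𝔤 hT₀
  exact ⟨δ, hδ, fun h => hne₀ ((upqTypeClasses_eq_bot_iff_of_equiv σK σ𝔤 hM.ad_compat σK₀ σ𝔤₀ hM₀.ad_compat
    e.toLinearEquiv e.comm𝔤 e.commK 1 δ).1 h)⟩

/-- **A token of a HOLOMORPHIC-type `P` has a non-zero class of type `+1`** (§1 with ★ `token_type_eq_one_of_isHolCotangentAt_cpt`).
[cite: BorelWallach2000, II §4.2 (3); VI Thm. 4.11] [cite: Rogawski1990, Prop. 15.2.1 (b); §15.3] -/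
theorem upqTypeClasses_one_ne_bot_of_token_of_isHolCotangentAt_cpt
    (hdef : ∀ τ' : L →+* ℂ, InfinitePlace.mk τ' ≠ InfinitePlace.mk ι → (H.map τ').PosDef) (h2 : 2 ≤ Module.finrank ℚ ↥(maximalRealSubfield L))
    (P : DiscreteAutomorphicRep (adelicGroupData (↥(maximalRealSubfield L)) L (IsCMField.complexConj L) 3 H) μ)
    (hP : P.IsHolCotangentAt (cmArchSection L ι H T hT) (cmCompactFactor L ι H T hT))
    (hM : IsGKModule (uFormGroup (Fin 2) (Fin 1)) σK σ𝔤) (hirr : IsIrreducibleGK σK σ𝔤)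
    (T₁ : P.archModuleCM ι T hT →ₗ[ℂ] M)
    (hT₁K : ∀ (k : (uFormGroup (Fin 2) (Fin 1)).maximalCompact) (w : P.archModuleCM ι T hT),
      T₁ (P.archRepKCM ι T hT k w) = σK k (T₁ w))
    (hT₁𝔤 : ∀ (X : (uFormGroup (Fin 2) (Fin 1)).lie) (w : P.archModuleCM ι T hT),
      T₁ (P.archRepLieCM ι T hT X w) = σ𝔤 X (T₁ w))
    (hT₁ : T₁ ≠ 0) :
    upqTypeClasses σK σ𝔤 hM.ad_compat 1 1 ≠ ⊥ := by
  obtain ⟨δ, hδ, hne⟩ := exists_upqTypeClasses_ne_bot_of_token_cpt L ι H T hT μ hdef h2 P (Or.inl hP) hM hirr T₁ hT₁K hT₁𝔤 hT₁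
  rwa [token_type_eq_one_of_isHolCotangentAt_cpt L ι H T hT μ hdef h2 P hP hM hirr T₁ hT₁K hT₁𝔤 hT₁ hδ hne] at hne

/-- **A token of an ANTIHOLOMORPHIC-type `P` has a non-zero class of type `−1`** (§1 with ★ `token_type_eq_neg_one_of_isAntiholCotangentAt_cpt`).
[cite: BorelWallach2000, II §4.2 (3); VI Thm. 4.11] [cite: Rogawski1990, Prop. 15.2.1 (b); §15.3] -/
theorem upqTypeClasses_neg_one_ne_bot_of_token_of_isAntiholCotangentAt_cpt
    (hdef : ∀ τ' : L →+* ℂ, InfinitePlace.mk τ' ≠ InfinitePlace.mk ι → (H.map τ').PosDef) (h2 : 2 ≤ Module.finrank ℚ ↥(maximalRealSubfield L))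
    (P : DiscreteAutomorphicRep (adelicGroupData (↥(maximalRealSubfield L)) L (IsCMField.complexConj L) 3 H) μ)
    (hP : P.IsAntiholCotangentAt (cmArchSection L ι H T hT) (cmCompactFactor L ι H T hT))
    (hM : IsGKModule (uFormGroup (Fin 2) (Fin 1)) σK σ𝔤) (hirr : IsIrreducibleGK σK σ𝔤)
    (T₁ : P.archModuleCM ι T hT →ₗ[ℂ] M)
    (hT₁K : ∀ (k : (uFormGroup (Fin 2) (Fin 1)).maximalCompact) (w : P.archModuleCM ι T hT),
      T₁ (P.archRepKCM ι T hT k w) = σK k (T₁ w))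
    (hT₁𝔤 : ∀ (X : (uFormGroup (Fin 2) (Fin 1)).lie) (w : P.archModuleCM ι T hT),
      T₁ (P.archRepLieCM ι T hT X w) = σ𝔤 X (T₁ w))
    (hT₁ : T₁ ≠ 0) :
    upqTypeClasses σK σ𝔤 hM.ad_compat 1 (-1) ≠ ⊥ := by
  obtain ⟨δ, hδ, hne⟩ := exists_upqTypeClasses_ne_bot_of_token_cpt L ι H T hT μ hdef h2 P (Or.inr hP) hM hirr T₁ hT₁K hT₁𝔤 hT₁
  rwa [token_type_eq_neg_one_of_isAntiholCotangentAt_cpt L ι H T hT μ hdef h2 P hP hM hirr T₁ hT₁K hT₁𝔤 hT₁ hδ hne] at hne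

end Cpt

end Summit.HodgeConjecture.HodgeConjecture.Cruxes.H413.F0P3cArchTokenCohomological

end
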